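import Literature.Algebra.Polynomial.CasasAlvero.DepressedReduction
import Mathlib.FieldTheory.IsAlgClosed.Basic
import HarnessLib

/-!
# Casas-Alvero: first constraints on counterexamples — the centre of mass is a root; at least three distinct roots

[CLO 2012, §2 ((general).3–(general).4, Lemma 11 with `r = 1`)]: for a monic polynomial `f` of degree `d` with `d ≠ 0`
in the field, the top Hasse derivative is `H_{d-1} f = d·X + a_{d-1}`, whose only root is the CENTRE OF MASS
`-a_{d-1}/d` of the roots of `f`.  Hence

* `IsCasasAlvero.eval_centerOfMass_eq_zero` — the centre of mass of the roots of a Casas-Alvero polynomial is itself a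
  root;
* `not_isCasasAlvero_X_sub_C_pow_mul_X_sub_C_pow` — `(X - a)^m (X - b)^n` with `a ≠ b`, `m, n ≥ 1` is NOT Casas-Alvero
  as soon as `m`, `n`, `m + n` are non-zero in the field (always, in characteristic `0`): "the number of distinct roots
  of a CA-polynomial cannot be two" [CLO 2012, (general).4];
* `IsCasasAlvero.three_le_card_roots` — over a field of characteristic `0`, a split Casas-Alvero polynomial that is not
  a pure `d`-th power has at least THREE distinct roots [CLO 2012, (general).3] (CLO go on to prove `≥ 5` over `ℂ`
  with the Gauss–Lucas theorem, Thm. 13; not formalised here).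
-/

noncomputable section

open Polynomial

namespace Literature.Algebra.Polynomial.CasasAlvero

variable {K : Type*} [Field K]

/-- **The centre of mass is a root** [CLO 2012, (general).4]: if `f` is monic Casas-Alvero of degree `d ≥ 2` and
`d ≠ 0` in `K`, then `f(-a_{d-1}/d) = 0`. [cite: CastryckLaterveerOunaies2012, Lemma 11] -/
theorem IsCasasAlvero.eval_centerOfMass_eq_zero {f : K[X]} {d : ℕ} (hf : f.Monic) (hd : f.natDegree = d)
    (h2 : 2 ≤ d) (hK : (d : K) ≠ 0) (hca : IsCasasAlvero f) :
    f.eval (-(f.coeff (d - 1)) / (d : K)) = 0 := by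
  obtain ⟨θ, hθf, hθH⟩ := hca (d - 1) (by omega) (by rw [hd]; omega)
  rw [hasseDeriv_natDegree_sub_one hf hd (by omega), eval_add, eval_mul, eval_C, eval_X, eval_C] at hθH
  have hθ : θ = -(f.coeff (d - 1)) / (d : K) := by
    field_simp
    linear_combination hθH
  rwa [hθ] at hθf

/-- the `X^{d-1}`-coefficient of `(X - a)^m (X - b)^n` is `-(m a + n b)`. [folklore] -/
private theorem coeff_two_powers (a b : K) (m n : ℕ) (hmn : 0 < m + n) :
    ((X - C a) ^ m * (X - C b) ^ n).coeff (m + n - 1) = -((m : K) * a + (n : K) * b) := by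
  have hmonic : ((X - C a) ^ m * (X - C b) ^ n).Monic :=
    ((monic_X_sub_C a).pow m).mul ((monic_X_sub_C b).pow n)
  have hdeg : ((X - C a) ^ m * (X - C b) ^ n).natDegree = m + n := by
    rw [((monic_X_sub_C a).pow m).natDegree_mul ((monic_X_sub_C b).pow n), natDegree_pow, natDegree_pow,
      natDegree_X_sub_C, natDegree_X_sub_C, mul_one, mul_one]
  have hnext := nextCoeff_of_natDegree_pos (p := (X - C a) ^ m * (X - C b) ^ n) (by rw [hdeg]; exact hmn)
  rw [hdeg] at hnext
  rw [← hnext, Monic.nextCoeff_mul ((monic_X_sub_C a).pow m) ((monic_X_sub_C b).pow n),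
    Monic.nextCoeff_pow (monic_X_sub_C a), Monic.nextCoeff_pow (monic_X_sub_C b), nextCoeff_X_sub_C,
    nextCoeff_X_sub_C, nsmul_eq_mul, nsmul_eq_mul]
  ring

/-- **A Casas-Alvero polynomial cannot have exactly two distinct roots** [CLO 2012, (general).4]: for `a ≠ b` and
`m, n ≥ 1` with `m`, `n`, `m + n` non-zero in `K` (e.g. `K` of characteristic `0`), `(X - a)^m (X - b)^n` is not
Casas-Alvero — the centre of mass `(m a + n b)/(m + n)` is not a root. [cite: CastryckLaterveerOunaies2012, §2] -/
theorem not_isCasasAlvero_X_sub_C_pow_mul_X_sub_C_pow {a b : K} (hab : a ≠ b) {m n : ℕ} (hm : 0 < m) (hn : 0 < n)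
    (hmK : (m : K) ≠ 0) (hnK : (n : K) ≠ 0) (hmnK : ((m + n : ℕ) : K) ≠ 0) :
    ¬ IsCasasAlvero ((X - C a) ^ m * (X - C b) ^ n) := by
  intro hca
  have hmonic : ((X - C a) ^ m * (X - C b) ^ n).Monic :=
    ((monic_X_sub_C a).pow m).mul ((monic_X_sub_C b).pow n)
  have hdeg : ((X - C a) ^ m * (X - C b) ^ n).natDegree = m + n := by
    rw [((monic_X_sub_C a).pow m).natDegree_mul ((monic_X_sub_C b).pow n), natDegree_pow, natDegree_pow,
      natDegree_X_sub_C, natDegree_X_sub_C, mul_one, mul_one]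
  have h0 := hca.eval_centerOfMass_eq_zero hmonic hdeg (by omega) hmnK
  rw [coeff_two_powers a b m n (by omega), eval_mul, eval_pow, eval_pow, eval_sub, eval_X, eval_C, eval_sub, eval_X,
    eval_C, mul_eq_zero] at h0
  have hmnK' : (m : K) + n ≠ 0 := by exact_mod_cast hmnK
  push_cast at h0
  rcases h0 with h0 | h0
  · have h1 := sub_eq_zero.mp ((pow_eq_zero_iff hm.ne').mp h0)
    apply hnK
    have : (n : K) * (b - a) = 0 := by
      field_simp at h1
      linear_combination h1
    exact (mul_eq_zero.mp this).resolve_right (sub_ne_zero.mpr (Ne.symm hab))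
  · have h1 := sub_eq_zero.mp ((pow_eq_zero_iff hn.ne').mp h0)
    apply hmK
    have : (m : K) * (a - b) = 0 := by
      field_simp at h1
      linear_combination h1
    exact (mul_eq_zero.mp this).resolve_right (sub_ne_zero.mpr hab)

/-- **At least three distinct roots** [CLO 2012, (general).3]: over a field of characteristic `0`, a monic
Casas-Alvero polynomial of degree `d` that splits and is not a pure `d`-th power has at least three distinct roots.
[cite: CastryckLaterveerOunaies2012, §2] -/
theorem IsCasasAlvero.three_le_card_roots [DecidableEq K] [CharZero K] {f : K[X]} {d : ℕ} (hf : f.Monic) (hd : f.natDegree = d)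
    (hsplit : Multiset.card f.roots = d) (hca : IsCasasAlvero f) (hne : ∀ c : K, f ≠ (X - C c) ^ d) :
    3 ≤ f.roots.toFinset.card := by
  set s := f.roots with hs
  have hprod : (s.map fun a => X - C a).prod = f :=
    prod_multiset_X_sub_C_of_monic_of_roots_card_eq hf (by rw [← hs, hsplit, hd])
  by_contra hlt
  push Not at hlt
  have hcount : ∀ a : K, s.count a ≤ d := fun a => (Multiset.count_le_card a s).trans hsplit.le
  -- write `f = ∏_{a ∈ s.toFinset} (X - a)^{count a}`
  have hprod' : f = ∏ a ∈ s.toFinset, (X - C a) ^ s.count a := by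
    rw [← hprod, Finset.prod_multiset_map_count]
  rcases Nat.lt_or_ge s.toFinset.card 2 with h1 | h2
  · -- at most one distinct root: `f` is a pure power
    have hsub := Finset.card_le_one.mp (show s.toFinset.card ≤ 1 by omega)
    by_cases hempty : s.toFinset = ∅
    · refine hne 0 ?_
      have hd0 : d = 0 := by
        rw [← hsplit]
        exact Multiset.card_eq_zero.mpr (Multiset.toFinset_eq_empty.mp hempty)
      rw [hprod', hempty, Finset.prod_empty, hd0, pow_zero]
    · obtain ⟨a, ha⟩ := Finset.nonempty_iff_ne_empty.mpr hempty
      have hsing : s.toFinset = {a} := Finset.eq_singleton_iff_unique_mem.mpr ⟨ha, fun b hb => hsub b hb a ha⟩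
      refine hne a ?_
      have hca' : s.count a = d := by
        have := Multiset.toFinset_sum_count_eq s
        rw [hsing, Finset.sum_singleton] at this
        rw [this, hsplit]
      rw [hprod', hsing, Finset.prod_singleton, hca']
  · -- exactly two distinct roots
    have hcard2 : s.toFinset.card = 2 := by omega
    obtain ⟨a, b, hab, hab'⟩ := Finset.card_eq_two.mp hcard2
    have ha : a ∈ s := Multiset.mem_toFinset.mp (hab' ▸ Finset.mem_insert_self a {b})
    have hb : b ∈ s := Multiset.mem_toFinset.mp (hab' ▸ Finset.mem_insert_of_mem (Finset.mem_singleton_self b))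
    have hfab : f = (X - C a) ^ s.count a * (X - C b) ^ s.count b := by
      rw [hprod', hab', Finset.prod_pair hab]
    have hm : 0 < s.count a := Multiset.count_pos.mpr ha
    have hn : 0 < s.count b := Multiset.count_pos.mpr hb
    refine not_isCasasAlvero_X_sub_C_pow_mul_X_sub_C_pow hab hm hn ?_ ?_ ?_ (hfab ▸ hca)
    · exact_mod_cast hm.ne'
    · exact_mod_cast hn.ne'
    · exact_mod_cast (Nat.add_pos_left hm _).ne'

/-- Over an algebraically closed field of characteristic `0`: a monic Casas-Alvero polynomial that is not a pure
power has at least three distinct roots. [cite: CastryckLaterveerOunaies2012, §2] -/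
theorem IsCasasAlvero.three_le_card_roots_of_isAlgClosed [DecidableEq K] [IsAlgClosed K] [CharZero K] {f : K[X]} {d : ℕ}
    (hf : f.Monic) (hd : f.natDegree = d) (hca : IsCasasAlvero f) (hne : ∀ c : K, f ≠ (X - C c) ^ d) :
    3 ≤ f.roots.toFinset.card :=
  hca.three_le_card_roots hf hd (by rw [IsAlgClosed.card_roots_eq_natDegree, hd]) hne

end Literature.Algebra.Polynomial.CasasAlvero
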